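import Summits.HodgeConjecture.CorCM.QuadraticCMFamiliesHodge
import HarnessLib

/-!
# Separating families of CM types of imaginary quadratic fields from generators `aᵢ² = −dᵢ`, and the census
# `ℚ(√-1), ℚ(√-2), ℚ(√-3), ℚ(√-6)`: four CM elliptic curves whose fields are NOT slotwise independent, all of whose
# products of powers satisfy the Hodge conjecture

COR-CM (cell `pub-hodgecm2`, seat `lit-deligne-3` gen 4), count-neutral, theorems only (no definition, no named fact).
Companion of `QuadraticCMFamiliesHodge` (separating family of CM types of imaginary quadratic fields ⟹ nondegenerate ⟹
`B = D` and the Hodge conjecture on every `∏_i E_i^{k_i}`), which takes the tree's `IsSeparatingFamily` ("simple, pairwise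
non-isogenous") as hypothesis.  Here that hypothesis is DERIVED from explicit generators: if `a_i ∈ K_i` with
`a_i² = −d_i` (`d_i ∈ ℕ`) and `d_i d_j` is not a square for `i ≠ j` (e.g. distinct squarefree `d_i`), the family is
separating — WITHOUT Galois theory of the compositum: for `i ≠ j` put `z = s(a_i)`, `w = t(a_j)`, `r = zw ∈ ℝ`,
`r² = d_i d_j`; `ℚ(r) ⊂ ℂ` is a real quadratic number field with an embedding `r ↦ −r`, so by transitivity of `Aut(ℂ)` on
`Hom(ℚ(r), ℂ)` (the tree's `isPretransitive_ringEquiv_complex`) some `τ ∈ Aut(ℂ)` has `τ r = −r`; as `τ z = ±z`,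
`τ w = ±w`, exactly one sign is `−`, i.e. `τ` fixes exactly one of the embeddings `s, t` and conjugates the other, which
contradicts `τ s ∈ Φ_i ↔ τ t ∈ Φ_j` for all `τ` (Kubota separation).  CENSUS: for CM fields `K_1, K_2, K_3, K_6` of degree
`2` containing `a_k` with `a_k² = −k` (`k = 1, 2, 3, 6`): (i) the Galois actions are NOT slotwise independent
(`s_6(a_6) = ± s_1(a_1) s_2(a_2) s_3(a_3)`, so an automorphism trivial on the first three slots is trivial on the fourth —
the hypothesis of `IndependentCMFieldsHodge` fails), yet (ii) every family of CM types on them is separating, hence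
nondegenerate, and every product `⨁_{j<N} E_{π j}` of realisations (CM elliptic curves with CM by `ℚ(√-1), ℚ(√-2), ℚ(√-3),
ℚ(√-6)`, any exponents, any order) has `B = D` and satisfies the Hodge conjecture, UNCONDITIONALLY.

Sources: Moonen–Zarhin, Math. Ann. 315 (1999), Cor. (3.9) (Imai) «Let `X₁, …, X_n` be elliptic curves over `ℂ`, no two of
which are isogenous … `Hg(X) = Hg(X₁) × ⋯ × Hg(X_n)`»; Kubota 1965 §2 (separation); Shimura 1998 §18.2 (`Aut(ℂ)` on
embeddings).  HONEST SCOPE: imaginary quadratic fields given with such generators; "`K_i ≄ K_j`" in abstract form is not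
treated; existence of the four fields / curves is not restated (Shimura §6.2 Thm. 3 is the tree's
`cmAbelianVarietyRealised_holds`).  Not a step of `HC_CM`/`HC_AV`.
-/

set_option autoImplicit false

noncomputable section

open CategoryTheory CategoryTheory.Limits NumberField Polynomial IntermediateField
open scoped BigOperators

namespace Summit.HodgeConjecture.CorCM

open Literature.NumberTheory.ComplexMultiplication
open Literature.AlgebraicGeometry.Motives (AbelianVariety CMType)
open Literature.AlgebraicGeometry.HodgeTheory
open Literature.AlgebraicGeometry.ComplexMultiplication (IsCMTypeRealisation)
open Literature.AlgebraicGeometry.VanGeemen1994 (hodgeClassSpan)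
open Literature.AlgebraicGeometry.Pohlmann1968
open Literature.Barriers.HodgeConjecture (divisorClassesSpan)

namespace QuadGen

/-! ### Complex numbers with `z² = −d`: `z̄ = −z`, `τ z = ± z` -/

/-- `z² = −d` (`d ∈ ℕ`) forces `Re z = 0`, i.e. `z̄ = −z`. [folklore] -/
theorem conj_eq_neg_of_sq_eq_neg {z : ℂ} {d : ℕ} (hz : z ^ 2 = -(d : ℂ)) : starRingEnd ℂ z = -z := by
  have hre := congrArg Complex.re hz
  have him := congrArg Complex.im hz
  simp only [sq, Complex.mul_re, Complex.mul_im, Complex.neg_re, Complex.neg_im, Complex.natCast_re,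
    Complex.natCast_im, neg_zero] at hre him
  have hx : z.re = 0 := by
    rcases mul_eq_zero.1 (show z.re * z.im = 0 by linarith) with h | h
    · exact h
    · have hd : (0 : ℝ) ≤ d := Nat.cast_nonneg d
      rw [h, mul_zero, sub_zero] at hre
      nlinarith
  apply Complex.ext <;> simp [hx]

/-- A ring automorphism of `ℂ` maps a square root of `−d` to `±` itself. [folklore] -/
theorem ringEquiv_apply_eq_or_eq_neg (τ : ℂ ≃+* ℂ) {z : ℂ} {d : ℕ} (hz : z ^ 2 = -(d : ℂ)) :
    τ z = z ∨ τ z = -z := by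
  have h : (τ z) ^ 2 = z ^ 2 := by rw [← map_pow, hz, map_neg, map_natCast]
  exact sq_eq_sq_iff_eq_or_eq_neg.1 h

/-- `z² = −d`, `d ≠ 0` ⟹ `z ≠ 0`. [folklore] -/
theorem ne_zero_of_sq_eq_neg {z : ℂ} {d : ℕ} (hz : z ^ 2 = -(d : ℂ)) (hd : d ≠ 0) : z ≠ 0 := by
  rintro rfl
  apply hd
  have : (d : ℂ) = 0 := by
    have h0 : (0 : ℂ) ^ 2 = 0 := by norm_num
    rw [h0] at hz
    exact neg_eq_zero.1 hz.symm
  exact_mod_cast this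

/-! ### A real quadratic irrationality is moved to its negative by some automorphism of `ℂ` -/

/-- **For `r ∈ ℂ` with `r² = D`, `D ∈ ℕ` not a square, some `τ ∈ Aut(ℂ)` has `τ r = −r`**: `ℚ(r) ⊂ ℂ` is a number field
with minimal polynomial `X² − D` (irreducible: Kummer, `p = 2`), it has the embedding `r ↦ −r`, and `Aut(ℂ)` acts
transitively on `Hom(ℚ(r), ℂ)` (the tree's `isPretransitive_ringEquiv_complex`). [cite: Shimura1998, §18.2 Lemma (i)] -/
theorem exists_ringEquiv_apply_eq_neg {r : ℂ} {D : ℕ} (hr : r ^ 2 = (D : ℂ)) (hD : ¬IsSquare D) :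
    ∃ τ : ℂ ≃+* ℂ, τ r = -r := by
  have hDq : ∀ b : ℚ, b ^ 2 ≠ (D : ℚ) := fun b hb =>
    hD (Rat.isSquare_natCast_iff.1 ⟨b, by rw [← hb, sq]⟩)
  have hirr : Irreducible (X ^ 2 - C (D : ℚ)) := (X_pow_sub_C_irreducible_iff_of_prime Nat.prime_two).2 hDq
  have hmonic : (X ^ 2 - C (D : ℚ)).Monic := monic_X_pow_sub_C _ two_ne_zero
  have haeval : aeval r (X ^ 2 - C (D : ℚ)) = 0 := by
    simp only [map_sub, map_pow, aeval_X, aeval_C, eq_ratCast, Rat.cast_natCast, hr, sub_self]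
  have hint : IsIntegral ℚ r := ⟨_, hmonic, by rwa [← aeval_def]⟩
  have hmin : minpoly ℚ r = X ^ 2 - C (D : ℚ) := (minpoly.eq_of_irreducible_of_monic hirr haeval hmonic).symm
  have hroot : -r ∈ (minpoly ℚ r).aroots ℂ := by
    rw [mem_aroots, hmin]
    refine ⟨hmonic.ne_zero, ?_⟩
    simp only [map_sub, map_pow, aeval_X, aeval_C, eq_ratCast, Rat.cast_natCast, neg_sq, hr, sub_self]
  haveI : FiniteDimensional ℚ ℚ⟮r⟯ := adjoin.finiteDimensional hint
  haveI : NumberField ℚ⟮r⟯ := NumberField.mk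
  haveI := isPretransitive_ringEquiv_complex (K := ℚ⟮r⟯)
  set u' : ℚ⟮r⟯ →ₐ[ℚ] ℂ := (algHomAdjoinIntegralEquiv ℚ hint).symm ⟨-r, hroot⟩ with hu'_def
  have hu' : u' (AdjoinSimple.gen ℚ r) = -r := algHomAdjoinIntegralEquiv_symm_apply_gen ℚ hint ⟨-r, hroot⟩
  obtain ⟨τ, hτ⟩ := MulAction.exists_smul_eq (ℂ ≃+* ℂ) (ℚ⟮r⟯.val : ℚ⟮r⟯ →+* ℂ) (u' : ℚ⟮r⟯ →+* ℂ)
  refine ⟨τ, ?_⟩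
  have h := congrArg (fun f : ℚ⟮r⟯ →+* ℂ => f (AdjoinSimple.gen ℚ r)) hτ
  change τ ((AdjoinSimple.gen ℚ r : ℚ⟮r⟯) : ℂ) = u' (AdjoinSimple.gen ℚ r) at h
  rwa [AdjoinSimple.coe_gen, hu'] at h

/-! ### Two quadratic slots with `a² = −d`, `a'² = −d'`, `dd'` not a square are separated -/

/-- The embeddings of a field of degree `2` carrying a CM type are `s` and `s̄`. [cite: Kubota1965, §2 (p. 115)] -/
theorem eq_or_eq_conj_smul {K : Type} [Field K] [NumberField K] [IsCMField K] (Φ : CMType K)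
    (hK : Module.finrank ℚ K = 2) (s t : K →+* ℂ) : t = s ∨ t = (starRingAut : ℂ ≃+* ℂ) • s := by
  classical
  have hc : Fintype.card (K →+* ℂ) = 2 := by rw [Embeddings.card, hK]
  exact TwoSlot.eq_or_eq_rho_smul (I := Unit) (E := fun _ => K →+* ℂ) (Φ := fun _ => Φ.1) (i := ())
    (isCMTypeWith_conj Φ) hc s t

/-- **Cross-slot separation from generators.**  For CM fields `K, K'` of degree `2` with `a² = −d`, `a'² = −d'` and `dd'`
not a square, any CM types `Φ, Φ'` and embeddings `s, t`: some `τ ∈ Aut(ℂ)` has `τs ∈ Φ ↮ τt ∈ Φ'` (the `τ` with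
`τ(s(a)t(a')) = −s(a)t(a')` fixes exactly one of `s, t`). [cite: MoonenZarhin1999LowDim, Cor. (3.9)] [cite: Kubota1965, §2 (p. 115)] -/
theorem exists_not_mem_iff {K K' : Type} [Field K] [NumberField K] [IsCMField K] [Field K'] [NumberField K']
    [IsCMField K'] (hK : Module.finrank ℚ K = 2) (hK' : Module.finrank ℚ K' = 2) {d d' : ℕ} {a : K} {a' : K'}
    (ha : a ^ 2 = -(d : K)) (ha' : a' ^ 2 = -(d' : K')) (hdd : ¬IsSquare (d * d')) (Φ : CMType K) (Φ' : CMType K')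
    (s : K →+* ℂ) (t : K' →+* ℂ) : ∃ τ : ℂ ≃+* ℂ, ¬(τ • s ∈ Φ.1 ↔ τ • t ∈ Φ'.1) := by
  have hz : (s a) ^ 2 = -(d : ℂ) := by rw [← map_pow, ha, map_neg, map_natCast]
  have hw : (t a') ^ 2 = -(d' : ℂ) := by rw [← map_pow, ha', map_neg, map_natCast]
  have hd0 : d ≠ 0 := by rintro rfl; exact hdd ⟨0, by simp⟩
  have hd0' : d' ≠ 0 := by rintro rfl; exact hdd ⟨0, by simp⟩
  have hz0 := ne_zero_of_sq_eq_neg hz hd0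
  have hw0 := ne_zero_of_sq_eq_neg hw hd0'
  have hr : (s a * t a') ^ 2 = ((d * d' : ℕ) : ℂ) := by rw [mul_pow, hz, hw, Nat.cast_mul]; ring
  obtain ⟨τ, hτ⟩ := exists_ringEquiv_apply_eq_neg hr hdd
  rw [map_mul] at hτ
  -- `τ` acts on `s` and `t` as identity or conjugation; on the generators by `±1`, with exactly one `−`.
  have key : ∀ {L : Type} [Field L] [NumberField L] [IsCMField L] (Ψ : CMType L) (hL : Module.finrank ℚ L = 2)
      (u : L →+* ℂ) {b : L} {e : ℕ} (hb : (u b) ^ 2 = -(e : ℂ)) (hb0 : u b ≠ 0),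
      (τ • u = u ∧ τ (u b) = u b) ∨ (τ • u = (starRingAut : ℂ ≃+* ℂ) • u ∧ τ (u b) = -u b) := by
    intro L _ _ _ Ψ hL u b e hb hb0
    rcases eq_or_eq_conj_smul Ψ hL u (τ • u) with h | h
    · exact Or.inl ⟨h, by rw [show τ (u b) = (τ • u) b from rfl, h]⟩
    · refine Or.inr ⟨h, ?_⟩
      rw [show τ (u b) = (τ • u) b from rfl, h]
      exact conj_eq_neg_of_sq_eq_neg hb
  have h1 : s ∈ Φ.1 ↔ ¬((starRingAut : ℂ ≃+* ℂ) • s ∈ Φ.1) := by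
    rw [(isCMTypeWith_conj Φ).rho_smul_mem_iff, not_not]
  have h1' : t ∈ Φ'.1 ↔ ¬((starRingAut : ℂ ≃+* ℂ) • t ∈ Φ'.1) := by
    rw [(isCMTypeWith_conj Φ').rho_smul_mem_iff, not_not]
  rcases key Φ hK s hz hz0 with ⟨hs, hsz⟩ | ⟨hs, hsz⟩ <;>
    rcases key Φ' hK' t hw hw0 with ⟨ht, htw⟩ | ⟨ht, htw⟩
  · exfalso; rw [hsz, htw] at hτ
    exact mul_ne_zero hz0 hw0 (self_eq_neg.1 hτ)
  · by_cases h0 : (s ∈ Φ.1 ↔ t ∈ Φ'.1)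
    · refine ⟨τ, fun h => ?_⟩
      rw [hs, ht] at h
      exact iff_not_self ((h.symm.trans h0).trans h1')
    · exact ⟨1, by rwa [one_smul, one_smul]⟩
  · by_cases h0 : (s ∈ Φ.1 ↔ t ∈ Φ'.1)
    · refine ⟨τ, fun h => ?_⟩
      rw [hs, ht] at h
      exact iff_not_self ((h.trans h0.symm).trans h1)
    · exact ⟨1, by rwa [one_smul, one_smul]⟩
  · exfalso; rw [hsz, htw, neg_mul_neg] at hτ
    exact mul_ne_zero hz0 hw0 (self_eq_neg.1 hτ)

end QuadGen

/-! ### Families of imaginary quadratic fields with generators `aᵢ² = −dᵢ` -/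

section Family

variable {I : Type} {K : I → Type} [∀ i, Field (K i)] [∀ i, NumberField (K i)] [∀ i, IsCMField (K i)]

/-- **Separation from generators**: CM types of imaginary quadratic fields `K_i ∋ a_i`, `a_i² = −d_i`, with `d_i d_j` not
a square for `i ≠ j`, form a separating family (Kubota separation of Deligne's `Σ`; "pairwise non-isogenous" CM elliptic
curves). [cite: Kubota1965, §2 (p. 115)] [cite: MoonenZarhin1999LowDim, Cor. (3.9)] -/
theorem isSeparatingFamily_of_sq_eq_neg (hK : ∀ i, Module.finrank ℚ (K i) = 2) {d : I → ℕ} {a : ∀ i, K i}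
    (ha : ∀ i, a i ^ 2 = -(d i : K i)) (hd : ∀ i j, i ≠ j → ¬IsSquare (d i * d j)) (Φ : ∀ i, CMType (K i)) :
    CMAlgebra.IsSeparatingFamily Φ := by
  rw [CMAlgebra.isSeparatingFamily_iff_smul]
  rintro ⟨i, s⟩ ⟨j, t⟩ H
  by_cases hij : i = j
  · subst hij
    have H1 : s ∈ (Φ i).1 ↔ t ∈ (Φ i).1 := by have h := H 1; rw [one_smul, one_smul] at h; exact h
    rcases QuadGen.eq_or_eq_conj_smul (Φ i) (hK i) s t with rfl | rfl
    · rfl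
    · exact (iff_not_self (H1.trans ((isCMTypeWith_conj (Φ i)).rho_smul_mem_iff s))).elim
  · obtain ⟨τ, hτ⟩ := QuadGen.exists_not_mem_iff (hK i) (hK j) (ha i) (ha j) (hd i j hij) (Φ i) (Φ j) s t
    exact (hτ (H τ)).elim

variable [Fintype I] [Nonempty I]

/-- **Nondegeneracy from generators**: such a family is nondegenerate (`rank = |I| + 1`; Imai / Moonen–Zarhin Cor. (3.9) in
rank form, for CM curves with CM by `ℚ(√-d_i)`, `d_i d_j` non-square). [cite: MoonenZarhin1999LowDim, Cor. (3.9)] -/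
theorem isNondegenerateFamily_of_sq_eq_neg (hK : ∀ i, Module.finrank ℚ (K i) = 2) {d : I → ℕ} {a : ∀ i, K i}
    (ha : ∀ i, a i ^ 2 = -(d i : K i)) (hd : ∀ i j, i ≠ j → ¬IsSquare (d i * d j)) (Φ : ∀ i, CMType (K i)) :
    CMAlgebra.IsNondegenerateFamily Φ :=
  isNondegenerateFamily_of_finrank_eq_two hK (isSeparatingFamily_of_sq_eq_neg hK ha hd Φ)

variable {Φ : ∀ i, CMType (K i)} {A : I → AbelianVariety ℂ} {ι : ∀ i, 𝓞 (K i) →+* End (A i)}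
  {θ : ∀ i, K i →+* Module.End ℂ (complexBetti (A i).X 1)}

/-- **`Bᵐ ⊗ ℂ = Dᵐ ⊗ ℂ` on every product `⨁_{j<N} E_{π j}` of CM elliptic curves with CM by `ℚ(√-d_i)`, `d_i d_j` non-square
for `i ≠ j`** (every realisation of any CM types of such fields). [cite: MoonenZarhin1999LowDim, Cor. (3.9)] -/
theorem hodgeClassSpan_prod_eq_divisorClassesSpan_of_sq_eq_neg (hK : ∀ i, Module.finrank ℚ (K i) = 2) {d : I → ℕ}
    {a : ∀ i, K i} (ha : ∀ i, a i ^ 2 = -(d i : K i)) (hd : ∀ i j, i ≠ j → ¬IsSquare (d i * d j))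
    (hA : ∀ i, IsCMTypeRealisation (Φ i) (A i) (ι i) (θ i)) {N : ℕ} (π : Fin N → I) (m : ℕ) :
    hodgeClassSpan (⨁ fun j : Fin N => A (π j)).dim (⨁ fun j : Fin N => A (π j)).X m =
      divisorClassesSpan (⨁ fun j : Fin N => A (π j)).X (⨁ fun j : Fin N => A (π j)).dim m :=
  (isNondegenerateFamily_of_sq_eq_neg hK ha hd Φ).hodgeClassSpan_prod_eq_divisorClassesSpan hA π m

/-- **The Hodge conjecture for every product `⨁_{j<N} E_{π j}` (every `∏_i E_i^{k_i}`) of CM elliptic curves with CM by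
imaginary quadratic fields `ℚ(√-d_i)`, `d_i d_j` not a square for `i ≠ j`**, UNCONDITIONAL, through the CM-type
combinatorics. [cite: MoonenZarhin1999LowDim, Cor. (3.9)] [cite: Gordon1999HodgeAVSurvey, §3 Theorem and 10.10] -/
theorem hodgeConjectureFor_prod_of_sq_eq_neg (hK : ∀ i, Module.finrank ℚ (K i) = 2) {d : I → ℕ} {a : ∀ i, K i}
    (ha : ∀ i, a i ^ 2 = -(d i : K i)) (hd : ∀ i j, i ≠ j → ¬IsSquare (d i * d j))
    (hA : ∀ i, IsCMTypeRealisation (Φ i) (A i) (ι i) (θ i)) {N : ℕ} (π : Fin N → I) :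
    HodgeConjectureFor (⨁ fun j : Fin N => A (π j)).dim (⨁ fun j : Fin N => A (π j)).X :=
  (isNondegenerateFamily_of_sq_eq_neg hK ha hd Φ).hodgeConjectureFor_prod hA π

end Family

/-! ### Census: `ℚ(√-1), ℚ(√-2), ℚ(√-3), ℚ(√-6)` — not slotwise independent, yet every product satisfies the Hodge conjecture -/

namespace Census1236

variable {K : Fin 4 → Type} [∀ k, Field (K k)] [∀ k, NumberField (K k)] [∀ k, IsCMField (K k)]

/-- `n` is not a square if no `r ≤ n` squares to it. [folklore] -/
private theorem not_isSquare_of_forall {n : ℕ} (h : ∀ r, r ≤ n → r * r ≠ n) : ¬IsSquare n :=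
  fun ⟨r, hr⟩ => h r (hr ▸ Nat.le_mul_self r) hr.symm

/-- `d_k d_l` is not a square for `k ≠ l` among `1, 2, 3, 6` (products `2, 3, 6, 12, 18`). [folklore] -/
theorem not_isSquare_mul :
    ∀ k l : Fin 4, k ≠ l → ¬IsSquare ((![1, 2, 3, 6] : Fin 4 → ℕ) k * (![1, 2, 3, 6] : Fin 4 → ℕ) l) := by
  intro k l hkl
  fin_cases k <;> fin_cases l <;> first | exact absurd rfl hkl | exact not_isSquare_of_forall (by decide)

omit [∀ k, IsCMField (K k)] in
/-- **The Galois actions on the embeddings of `ℚ(√-1), ℚ(√-2), ℚ(√-3), ℚ(√-6)` are NOT slotwise independent**: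
`s_6(a_6) = ± s_1(a_1) s_2(a_2) s_3(a_3)` (both square to `−6`), so an automorphism of `ℂ` trivial on the first three slots
fixes `s_6(a_6)`, whereas independence would provide one acting as complex conjugation on the fourth slot only — the
hypothesis of `IndependentCMFieldsHodge` fails for these four CM elliptic curves. [cite: Gordon1999HodgeAVSurvey, §3 Theorem (proof)] -/
theorem not_slotwiseIndependent (a : ∀ k, K k) (ha : ∀ k, a k ^ 2 = -((![1, 2, 3, 6] : Fin 4 → ℕ) k : K k)) :
    ¬SlotwiseIndependent (ℂ ≃+* ℂ) fun k => K k →+* ℂ := by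
  intro hind
  have s : ∀ k, K k →+* ℂ := fun k => Classical.arbitrary _
  have hz : ∀ k, (s k (a k)) ^ 2 = -((![1, 2, 3, 6] : Fin 4 → ℕ) k : ℂ) := fun k => by
    rw [← map_pow, ha, map_neg, map_natCast]
  obtain ⟨τ, hτ, hτ'⟩ := hind 3 starRingAut
  -- `τ` is trivial on the slots `0, 1, 2`:
  have hfix : ∀ k : Fin 4, k ≠ 3 → τ (s k (a k)) = s k (a k) := fun k hk => by
    rw [show τ (s k (a k)) = (τ • s k) (a k) from rfl, hτ' k hk]
  -- the product `P = z_0 z_1 z_2` squares to `−6 = z_3²`: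
  have hP : (s 0 (a 0) * s 1 (a 1) * s 2 (a 2)) ^ 2 = (s 3 (a 3)) ^ 2 := by
    rw [mul_pow, mul_pow, hz 0, hz 1, hz 2, hz 3]
    simp only [Matrix.cons_val_zero, Matrix.cons_val_one, Matrix.cons_val]
    push_cast; ring
  have hτP : τ (s 0 (a 0) * s 1 (a 1) * s 2 (a 2)) = s 0 (a 0) * s 1 (a 1) * s 2 (a 2) := by
    rw [map_mul, map_mul, hfix 0 (by decide), hfix 1 (by decide), hfix 2 (by decide)]
  have hτ3 : τ (s 3 (a 3)) = s 3 (a 3) := by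
    rcases sq_eq_sq_iff_eq_or_eq_neg.1 hP.symm with h | h
    · rw [h, hτP]
    · rw [h, map_neg, hτP]
  -- but `τ` acts as complex conjugation on the fourth slot: `τ z_3 = z̄_3 = −z_3 ≠ z_3`.
  have hconj : τ (s 3 (a 3)) = -s 3 (a 3) := by
    rw [show τ (s 3 (a 3)) = (τ • s 3) (a 3) from rfl, hτ (s 3)]
    exact QuadGen.conj_eq_neg_of_sq_eq_neg (hz 3)
  have h6 : s 3 (a 3) ≠ 0 := QuadGen.ne_zero_of_sq_eq_neg (hz 3) (by decide)
  rw [hτ3] at hconj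
  exact h6 (self_eq_neg.1 hconj)

variable {Φ : ∀ k, CMType (K k)} {A : Fin 4 → AbelianVariety ℂ} {ι : ∀ k, 𝓞 (K k) →+* End (A k)}
  {θ : ∀ k, K k →+* Module.End ℂ (complexBetti (A k).X 1)}

/-- **Every family of CM types of `ℚ(√-1), ℚ(√-2), ℚ(√-3), ℚ(√-6)` is nondegenerate** (`rank Y(MT(E_1 × E_2 × E_3 × E_6)) = 5`)
although the four Galois actions are not independent. [cite: MoonenZarhin1999LowDim, Cor. (3.9)] -/
theorem isNondegenerateFamily (hK : ∀ k, Module.finrank ℚ (K k) = 2) (a : ∀ k, K k)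
    (ha : ∀ k, a k ^ 2 = -((![1, 2, 3, 6] : Fin 4 → ℕ) k : K k)) (Φ : ∀ k, CMType (K k)) :
    CMAlgebra.IsNondegenerateFamily Φ :=
  isNondegenerateFamily_of_sq_eq_neg hK ha not_isSquare_mul Φ

/-- **The Hodge conjecture for every product `∏ E_k^{n_k}` (every `⨁_{j<N} E_{π j}`, any order) of CM elliptic curves with
CM by `ℚ(√-1), ℚ(√-2), ℚ(√-3), ℚ(√-6)`** — realisations of any CM types of four quadratic CM fields with `a_k² = −k`,
`k = 1, 2, 3, 6` — UNCONDITIONAL, through Deligne's rank, in a case where slotwise independence fails.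
[cite: MoonenZarhin1999LowDim, Cor. (3.9)] [cite: Gordon1999HodgeAVSurvey, §3 Theorem and 10.10] -/
theorem hodgeConjectureFor_prod (hK : ∀ k, Module.finrank ℚ (K k) = 2) (a : ∀ k, K k)
    (ha : ∀ k, a k ^ 2 = -((![1, 2, 3, 6] : Fin 4 → ℕ) k : K k))
    (hA : ∀ k, IsCMTypeRealisation (Φ k) (A k) (ι k) (θ k)) {N : ℕ} (π : Fin N → Fin 4) :
    HodgeConjectureFor (⨁ fun j : Fin N => A (π j)).dim (⨁ fun j : Fin N => A (π j)).X :=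
  hodgeConjectureFor_prod_of_sq_eq_neg hK ha not_isSquare_mul hA π

/-- `B = D` on all these products. [cite: MoonenZarhin1999LowDim, Cor. (3.9)] -/
theorem hodgeClassSpan_prod_eq_divisorClassesSpan (hK : ∀ k, Module.finrank ℚ (K k) = 2) (a : ∀ k, K k)
    (ha : ∀ k, a k ^ 2 = -((![1, 2, 3, 6] : Fin 4 → ℕ) k : K k))
    (hA : ∀ k, IsCMTypeRealisation (Φ k) (A k) (ι k) (θ k)) {N : ℕ} (π : Fin N → Fin 4) (m : ℕ) :
    hodgeClassSpan (⨁ fun j : Fin N => A (π j)).dim (⨁ fun j : Fin N => A (π j)).X m =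
      divisorClassesSpan (⨁ fun j : Fin N => A (π j)).X (⨁ fun j : Fin N => A (π j)).dim m :=
  hodgeClassSpan_prod_eq_divisorClassesSpan_of_sq_eq_neg hK ha not_isSquare_mul hA π m

end Census1236



end Summit.HodgeConjecture.CorCM

end
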